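import Mathlib

/-!
# `NewtonTauWeak` (stmt-ValiantsHypothesis-5904), stub `fixedKCoincidence_t2_K3` (siege k13): direction
# classes of an exponent list

Support file of siege k13 (elementary number theory only).  A list of nonzero exponents `d_j ∈ ℕ²` is grouped
by PRIMITIVE DIRECTION: `d_j = k_j · q_{cls j}` with `k_j = gcd(d_j) ≥ 1` and `q_e` primitive; distinct classes
have non-parallel directions (two parallel primitive vectors of `ℕ²` are equal), and parallel exponents lie in the
same class.  Packaged as one existence statement `exists_classes` (classes indexed by `Fin s`, with
representatives), so that no definition is needed downstream. [folklore]
-/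

-- the namespace mandated for this Theorems file repeats the component `ValiantsHypothesis`
set_option linter.dupNamespace false

noncomputable section

open scoped BigOperators

namespace Summit.ValiantsHypothesis.ValiantsHypothesis.Theorems.NewtonTauWeakSiegeK13

/-- Two parallel vectors of `ℕ²` with coprime coordinates are equal. [folklore] -/
theorem eq_of_coprime_of_parallel (p p' : Fin 2 →₀ ℕ) (hp : Nat.Coprime (p 0) (p 1))
    (hp' : Nat.Coprime (p' 0) (p' 1)) (hpar : p 0 * p' 1 = p 1 * p' 0) : p = p' := by
  have h0 : p 0 = p' 0 := by
    apply Nat.dvd_antisymm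
    · exact hp.dvd_of_dvd_mul_left ⟨p' 1, by rw [hpar]⟩
    · exact hp'.dvd_of_dvd_mul_left ⟨p 1, by linarith [hpar]⟩
  have h1 : p 1 = p' 1 := by
    apply Nat.dvd_antisymm
    · exact hp.symm.dvd_of_dvd_mul_left ⟨p' 0, by linarith [hpar]⟩
    · exact hp'.symm.dvd_of_dvd_mul_left ⟨p 0, by linarith [hpar]⟩
  ext i
  fin_cases i
  · exact h0
  · exact h1

/-- The primitive direction and the multiplicity of a nonzero vector of `ℕ²`. [folklore] -/
theorem exists_primitive (d : Fin 2 →₀ ℕ) (hd : d ≠ 0) :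
    ∃ (k : ℕ) (q : Fin 2 →₀ ℕ), 1 ≤ k ∧ d = k • q ∧ Nat.Coprime (q 0) (q 1) := by
  set g : ℕ := Nat.gcd (d 0) (d 1) with hg
  have hgpos : 0 < g := by
    rcases Nat.eq_zero_or_pos (d 0) with h0 | h0
    · have h1 : d 1 ≠ 0 := by
        intro h1
        apply hd
        ext i
        fin_cases i
        · exact h0
        · exact h1
      exact Nat.gcd_pos_of_pos_right _ (Nat.pos_of_ne_zero h1)
    · exact Nat.gcd_pos_of_pos_left _ h0
  refine ⟨g, Finsupp.equivFunOnFinite.symm fun i => d i / g, hgpos, ?_, ?_⟩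
  · ext i
    simp only [Finsupp.smul_apply, smul_eq_mul, Finsupp.coe_equivFunOnFinite_symm]
    fin_cases i
    · exact (Nat.mul_div_cancel' (Nat.gcd_dvd_left _ _)).symm
    · exact (Nat.mul_div_cancel' (Nat.gcd_dvd_right _ _)).symm
  · simp only [Finsupp.coe_equivFunOnFinite_symm]
    exact Nat.coprime_div_gcd_div_gcd hgpos

/-- **Direction classes.**  Nonzero exponents `d_j ∈ ℕ²` split into `s` classes `cls j` with primitive
directions `q_e ≠ 0`, multiplicities `k_j ≥ 1` (`d_j = k_j q_{cls j}`), representatives `rep e`, distinct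
classes non-parallel, parallel exponents in one class. [folklore] -/
theorem exists_classes {ι : Type*} [Fintype ι] (d : ι → Fin 2 →₀ ℕ) (hd : ∀ j, d j ≠ 0) :
    ∃ (s : ℕ) (cls : ι → Fin s) (q : Fin s → Fin 2 →₀ ℕ) (k : ι → ℕ) (rep : Fin s → ι),
      (∀ j, 1 ≤ k j) ∧ (∀ j, d j = k j • q (cls j)) ∧ (∀ e, cls (rep e) = e) ∧ (∀ e, q e ≠ 0) ∧
      (∀ e e', (q e 0 : ℤ) * (q e' 1) = (q e 1 : ℤ) * (q e' 0) → e = e') ∧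
      (∀ j j', (d j 0 : ℤ) * (d j' 1) = (d j 1 : ℤ) * (d j' 0) → cls j = cls j') := by
  classical
  choose k q hk hdq hcop using fun j => exists_primitive (d j) (hd j)
  -- the set of primitive directions and its enumeration
  set Q : Finset (Fin 2 →₀ ℕ) := Finset.univ.image q with hQ
  set s : ℕ := Q.card
  let φ : Q ≃ Fin s := Q.equivFin
  have hmem : ∀ j, q j ∈ Q := fun j => Finset.mem_image_of_mem q (Finset.mem_univ j)
  let cls : ι → Fin s := fun j => φ ⟨q j, hmem j⟩
  let qq : Fin s → Fin 2 →₀ ℕ := fun e => (φ.symm e).1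
  have hrep : ∀ e : Fin s, ∃ j, q j = qq e := by
    intro e
    have hm : (φ.symm e).1 ∈ Finset.univ.image q := (φ.symm e).2
    obtain ⟨j, -, hj⟩ := Finset.mem_image.mp hm
    exact ⟨j, hj⟩
  choose rep hrepq using hrep
  have hqq : ∀ j, qq (cls j) = q j := by
    intro j
    show (φ.symm (φ ⟨q j, hmem j⟩)).1 = q j
    rw [Equiv.symm_apply_apply]
  -- coprimality of the enumerated directions
  have hcopqq : ∀ e, Nat.Coprime (qq e 0) (qq e 1) := by
    intro e
    rw [← hrepq e]
    exact hcop (rep e)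
  -- parallel criterion for multiples of coprime vectors
  have hpar : ∀ j j', (d j 0 : ℤ) * (d j' 1) = (d j 1 : ℤ) * (d j' 0) → q j = q j' := by
    intro j j' h
    have h' : d j 0 * d j' 1 = d j 1 * d j' 0 := by exact_mod_cast h
    rw [hdq j, hdq j'] at h'
    simp only [Finsupp.smul_apply, smul_eq_mul] at h'
    have hkk : 0 < k j * k j' := Nat.mul_pos (hk j) (hk j')
    apply eq_of_coprime_of_parallel _ _ (hcop j) (hcop j')
    have : k j * k j' * (q j 0 * q j' 1) = k j * k j' * (q j 1 * q j' 0) := by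
      calc k j * k j' * (q j 0 * q j' 1) = (k j * q j 0) * (k j' * q j' 1) := by ring
        _ = (k j * q j 1) * (k j' * q j' 0) := h'
        _ = k j * k j' * (q j 1 * q j' 0) := by ring
    exact Nat.eq_of_mul_eq_mul_left hkk this
  refine ⟨s, cls, qq, k, rep, hk, fun j => by rw [hqq]; exact hdq j, fun e => ?_, fun e => ?_, fun e e' h => ?_,
    fun j j' h => ?_⟩
  · -- `cls (rep e) = e`
    apply φ.symm.injective
    apply Subtype.ext
    show (φ.symm (φ ⟨q (rep e), hmem (rep e)⟩)).1 = (φ.symm e).1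
    rw [Equiv.symm_apply_apply]
    exact hrepq e
  · -- `qq e ≠ 0`
    intro h0
    apply hd (rep e)
    rw [hdq (rep e), hrepq e, h0, smul_zero]
  · -- distinct classes are non-parallel
    have h' : qq e 0 * qq e' 1 = qq e 1 * qq e' 0 := by exact_mod_cast h
    have heq := eq_of_coprime_of_parallel _ _ (hcopqq e) (hcopqq e') h'
    apply φ.symm.injective
    exact Subtype.ext heq
  · -- parallel exponents are in one class
    show φ ⟨q j, hmem j⟩ = φ ⟨q j', hmem j'⟩
    congr 1
    exact Subtype.ext (hpar j j' h)

end Summit.ValiantsHypothesis.ValiantsHypothesis.Theorems.NewtonTauWeakSiegeK13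

end
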